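import Literature.NumberTheory.Transcendental.NesterenkoChowFormDistinct
import Literature.NumberTheory.Transcendental.NesterenkoEliminationZerosGeneric
import Mathlib.FieldTheory.IsAlgClosed.AlgebraicClosure
import HarnessLib

/-!
# Distinct prime ideals have distinct Chow forms — over an ARBITRARY field (LNM 1752 Ch. 3 Prop. 4.4, input (4))

`Literature/NumberTheory/Transcendental/NesterenkoChowFormDistinctK.lean` — proofs only. The tree's
`NesterenkoChowFormDistinct.lean` proves, for homogeneous primes `𝔭, 𝔭' ⊂ ℚ[x₀, …, x_m]` of the
same dimension `r − 1 ≥ 0`, that `𝔭̄(r) = 𝔭̄'(r) ⟹ 𝔭 = 𝔭'` (`Nesterenko.eq_of_elimIdeal_eq`,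
hypothesis (4) of `NesterenkoPhilippon2001_ch3_prop_4_4_of`), its field-theoretic lemmas being
already stated over any field `K` (`NesterenkoK.aeval_xbar_eq_zero_iff`,
`NesterenkoK.aeval_pivot_eq_zero_iff`, `NesterenkoK.sum_pivot_mul_eq`, …); only the final count
used `K = ℚ` (through the Hauptsatz of `NesterenkoEliminationZerosK.lean`, stated for ideals of
`ℚ[x̲]`). Chapter 10 of the book needs Proposition 4.4 over `K = ℂ(z)` (p. 153), so this file
re-runs that final count over an ARBITRARY field `K`, with the generic Hauptsatz
`NesterenkoK.exists_mem_elimIdeal_aeval_ne_zero` (`NesterenkoEliminationZerosGeneric.lean`):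

* `NesterenkoK.false_of_off_generic_point` — the transcendence-degree count;
* `NesterenkoK.le_of_elimIdeal_eq`, **`NesterenkoK.eq_of_elimIdeal_eq`** — for homogeneous primes
  `𝔭, 𝔭' ⊂ K[x₀, …, x_m]` with `dim K[x̲]/𝔭 = dim K[x̲]/𝔭' = r`, `1 ≤ r`:
  `𝔭̄(r) = 𝔭̄'(r) ⟹ 𝔭 = 𝔭'` (Hodge–Pedoe II, Ch. X §7: "no two distinct varieties can have the
  same Cayley form").

The argument is that of the `ℚ` file verbatim (generic point `ξ = (x̄ₖ)` of `V(𝔭)` in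
`L = Frac(K[x̲]/𝔭)`, generic hyperplanes `Φⱼ(u_{ik})` through `ξ`, a common zero `β` on `V(𝔭')`
from the Hauptsatz in an algebraic closure `Ω` of `Frac(L[U])`, and the count
`rm + r ≤ trdeg ≤ r + (r − 1) + r(m − 1)` unless `β` is proportional to `ξ`); over a general `K`
the auxiliary field `Ω` is reached through the canonical tower `K → L[U] → Frac(L[U]) → Ω`
(`IsScalarTower.toAlgHom`) instead of `RingHom.toRatAlgHom`.

## References

* [NesterenkoPhilippon2001] Yu. V. Nesterenko, P. Philippon (eds.), *Introduction to Algebraic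
  Independence Theory*, LNM 1752, Springer 2001, Ch. 3 Prop. 4.4 (p. 38); Ch. 10 §2 (p. 153).
* W. V. D. Hodge, D. Pedoe, *Methods of Algebraic Geometry* II, CUP 1952, Ch. X §§6–8.
* Zhu Yaochen, *Transcendental numbers: algebraic independence* (USTC Press), App. 2, Lemma 7.
-/

noncomputable section

open MvPolynomial Cardinal

namespace Literature.NumberTheory.Transcendental

namespace NesterenkoK

universe u

variable {K : Type u} [Field K] {m : ℕ}

set_option synthInstance.maxHeartbeats 400000 in
set_option maxHeartbeats 1600000 in
/-- **The transcendence-degree count** behind "the Chow form determines the variety": with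
`ξ = (x̄ₖ)` the generic point of `V(𝔭)` (`dim = r' = r − 1`) and `u_{ik}` (`k ≠ j`) independent
variables over `K(ξ)`, no normalised zero `β` (`β_{k₁} = 1`) of a second homogeneous prime `𝔭'`
of the same dimension can satisfy the `r` linear conditions `∑_{k≠j} u_{ik} γₖ = 0`,
`γₖ = βₖ − ξₖ ξⱼ⁻¹ βⱼ`, unless `γ = 0`: otherwise `K[ξ, u]` (transcendence degree `r'+1 + (r'+1)m`)
would be algebraic over `K[ξ, β, u_{ik} (k ≠ j, k₀)]`, of transcendence degree
`≤ (r'+1) + r' + (r'+1)(m−1)`. [folklore] -/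
theorem false_of_off_generic_point {r' : ℕ} (𝔭 : Ideal (MvPolynomial (Fin (m + 1)) K)) [h𝔭 : 𝔭.IsPrime]
    (hdim : ringKrullDim (MvPolynomial (Fin (m + 1)) K ⧸ 𝔭) = (r' + 1 : ℕ)) {j : Fin (m + 1)} (hj : (X j : MvPolynomial (Fin (m + 1)) K) ∉ 𝔭)
    (𝔭' : Ideal (MvPolynomial (Fin (m + 1)) K)) [h𝔭' : 𝔭'.IsPrime]
    (hhom' : letI := MvPolynomial.gradedAlgebra (σ := Fin (m + 1)) (R := K)
      𝔭'.IsHomogeneous (homogeneousSubmodule (Fin (m + 1)) K))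
    (hdim' : ringKrullDim (MvPolynomial (Fin (m + 1)) K ⧸ 𝔭') = (r' + 1 : ℕ))
    {Ω : Type u} [Field Ω] [Algebra K Ω]
    (φL : (MvPolynomial (Fin (r' + 1) × Fin (m + 1)) (FractionRing (MvPolynomial (Fin (m + 1)) K ⧸ 𝔭))) →ₐ[K] Ω) (hφ : Function.Injective φL)
    (β : Fin (m + 1) → Ω) {k₁ : Fin (m + 1)} (hβk₁ : β k₁ = 1) (hβI : ∀ P ∈ 𝔭', aeval β P = 0)
    (hγ : ∀ i : Fin (r' + 1), ∑ k : {k : Fin (m + 1) // k ≠ j},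
      φL (X (i, (k : Fin (m + 1)))) *
        (β k - φL (C (NesterenkoK.xbar 𝔭 k)) * (φL (C (NesterenkoK.xbar 𝔭 j)))⁻¹ * β j) = 0)
    {k₀ : {k : Fin (m + 1) // k ≠ j}}
    (hk₀ : β k₀ - φL (C (NesterenkoK.xbar 𝔭 k₀)) * (φL (C (NesterenkoK.xbar 𝔭 j)))⁻¹ * β j ≠ 0) :
    False := by
  classical
  have hm : 1 ≤ m := by
    rcases Nat.eq_zero_or_pos m with hm0 | hm0
    · subst hm0
      exact absurd (Fin.ext (by have := k₀.1.isLt; have := j.isLt; omega)) k₀.2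
    · exact hm0
  -- the `L`-algebra structure on `Ω` given by `φL ∘ C`, and the tower `K ⊆ L ⊆ Ω`
  letI instLΩ : Algebra (FractionRing (MvPolynomial (Fin (m + 1)) K ⧸ 𝔭)) Ω := ((φL : (MvPolynomial (Fin (r' + 1) × Fin (m + 1)) (FractionRing (MvPolynomial (Fin (m + 1)) K ⧸ 𝔭))) →+* Ω).comp (algebraMap (FractionRing (MvPolynomial (Fin (m + 1)) K ⧸ 𝔭)) (MvPolynomial (Fin (r' + 1) × Fin (m + 1)) (FractionRing (MvPolynomial (Fin (m + 1)) K ⧸ 𝔭))))).toAlgebra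
  have hφC : ∀ y : (FractionRing (MvPolynomial (Fin (m + 1)) K ⧸ 𝔭)), φL (C y) = algebraMap (FractionRing (MvPolynomial (Fin (m + 1)) K ⧸ 𝔭)) Ω y := fun y => rfl
  haveI := IsScalarTower.of_algebraMap_eq (R := K) (S := (FractionRing (MvPolynomial (Fin (m + 1)) K ⧸ 𝔭))) (A := Ω) fun q => by
    show algebraMap K Ω q = φL (algebraMap (FractionRing (MvPolynomial (Fin (m + 1)) K ⧸ 𝔭)) (MvPolynomial (Fin (r' + 1) × Fin (m + 1)) (FractionRing (MvPolynomial (Fin (m + 1)) K ⧸ 𝔭))) (algebraMap K (FractionRing (MvPolynomial (Fin (m + 1)) K ⧸ 𝔭)) q))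
    rw [← IsScalarTower.algebraMap_apply K (FractionRing (MvPolynomial (Fin (m + 1)) K ⧸ 𝔭)) (MvPolynomial (Fin (r' + 1) × Fin (m + 1)) (FractionRing (MvPolynomial (Fin (m + 1)) K ⧸ 𝔭))) q, AlgHom.commutes]
  -- `φL` as an `L`-algebra map
  let φT : (MvPolynomial (Fin (r' + 1) × Fin (m + 1)) (FractionRing (MvPolynomial (Fin (m + 1)) K ⧸ 𝔭))) →ₐ[(FractionRing (MvPolynomial (Fin (m + 1)) K ⧸ 𝔭))] Ω := { (φL : (MvPolynomial (Fin (r' + 1) × Fin (m + 1)) (FractionRing (MvPolynomial (Fin (m + 1)) K ⧸ 𝔭))) →+* Ω) with commutes' := fun _ => rfl }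
  have hφT : Function.Injective φT := hφ
  -- (B1) everything in `Sξ ∪ Sβ ∪ SU` is algebraic over `T = K[Sξ ∪ Sβ ∪ SU']`
  have hmemT : ∀ x, x ∈ ((Set.range (fun k : Fin (m + 1) => φL (C (NesterenkoK.xbar 𝔭 k)))) ∪ (Set.range β)) ∪ (Set.range (fun p : Fin (r' + 1) × {k : Fin (m + 1) // k ≠ j ∧ k ≠ (k₀ : Fin (m + 1))} => φL (X (p.1, (p.2 : Fin (m + 1)))))) → IsAlgebraic (Algebra.adjoin K (((Set.range (fun k : Fin (m + 1) => φL (C (NesterenkoK.xbar 𝔭 k)))) ∪ (Set.range β)) ∪ (Set.range (fun p : Fin (r' + 1) × {k : Fin (m + 1) // k ≠ j ∧ k ≠ (k₀ : Fin (m + 1))} => φL (X (p.1, (p.2 : Fin (m + 1)))))))) x := fun x hx =>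
    isAlgebraic_algebraMap (⟨x, Algebra.subset_adjoin hx⟩ : (Algebra.adjoin K (((Set.range (fun k : Fin (m + 1) => φL (C (NesterenkoK.xbar 𝔭 k)))) ∪ (Set.range β)) ∪ (Set.range (fun p : Fin (r' + 1) × {k : Fin (m + 1) // k ≠ j ∧ k ≠ (k₀ : Fin (m + 1))} => φL (X (p.1, (p.2 : Fin (m + 1)))))))))
  have hξT : ∀ k : Fin (m + 1), IsAlgebraic (Algebra.adjoin K (((Set.range (fun k : Fin (m + 1) => φL (C (NesterenkoK.xbar 𝔭 k)))) ∪ (Set.range β)) ∪ (Set.range (fun p : Fin (r' + 1) × {k : Fin (m + 1) // k ≠ j ∧ k ≠ (k₀ : Fin (m + 1))} => φL (X (p.1, (p.2 : Fin (m + 1)))))))) (φL (C (NesterenkoK.xbar 𝔭 k))) :=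
    fun k => hmemT _ (Or.inl (Or.inl ⟨k, rfl⟩))
  have hβT : ∀ k : Fin (m + 1), IsAlgebraic (Algebra.adjoin K (((Set.range (fun k : Fin (m + 1) => φL (C (NesterenkoK.xbar 𝔭 k)))) ∪ (Set.range β)) ∪ (Set.range (fun p : Fin (r' + 1) × {k : Fin (m + 1) // k ≠ j ∧ k ≠ (k₀ : Fin (m + 1))} => φL (X (p.1, (p.2 : Fin (m + 1)))))))) (β k) := fun k => hmemT _ (Or.inl (Or.inr ⟨k, rfl⟩))
  have hγT : ∀ k : Fin (m + 1), IsAlgebraic (Algebra.adjoin K (((Set.range (fun k : Fin (m + 1) => φL (C (NesterenkoK.xbar 𝔭 k)))) ∪ (Set.range β)) ∪ (Set.range (fun p : Fin (r' + 1) × {k : Fin (m + 1) // k ≠ j ∧ k ≠ (k₀ : Fin (m + 1))} => φL (X (p.1, (p.2 : Fin (m + 1))))))))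
      (β k - φL (C (NesterenkoK.xbar 𝔭 k)) * (φL (C (NesterenkoK.xbar 𝔭 j)))⁻¹ * β j) :=
    fun k => (hβT k).sub (((hξT k).mul (hξT j).inv).mul (hβT j))
  have halgU : ∀ x ∈ ((Set.range (fun k : Fin (m + 1) => φL (C (NesterenkoK.xbar 𝔭 k)))) ∪ (Set.range β)) ∪ (Set.range (fun p : Fin (r' + 1) × {k : Fin (m + 1) // k ≠ j} => φL (X (p.1, (p.2 : Fin (m + 1)))))), IsAlgebraic (Algebra.adjoin K (((Set.range (fun k : Fin (m + 1) => φL (C (NesterenkoK.xbar 𝔭 k)))) ∪ (Set.range β)) ∪ (Set.range (fun p : Fin (r' + 1) × {k : Fin (m + 1) // k ≠ j ∧ k ≠ (k₀ : Fin (m + 1))} => φL (X (p.1, (p.2 : Fin (m + 1)))))))) x := by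
    intro x hx
    rcases hx with hx | ⟨⟨i, k⟩, rfl⟩
    · exact hmemT x (Or.inl hx)
    · dsimp only
      by_cases hkk : (k : Fin (m + 1)) = (k₀ : Fin (m + 1))
      · have hkk' : k = k₀ := Subtype.ext hkk
        rw [hkk']
        -- isolate `u_{ik₀}` in the linear relation
        have hrel := hγ i
        rw [← Finset.add_sum_erase _ _ (Finset.mem_univ k₀)] at hrel
        have hrest : IsAlgebraic (Algebra.adjoin K (((Set.range (fun k : Fin (m + 1) => φL (C (NesterenkoK.xbar 𝔭 k)))) ∪ (Set.range β)) ∪ (Set.range (fun p : Fin (r' + 1) × {k : Fin (m + 1) // k ≠ j ∧ k ≠ (k₀ : Fin (m + 1))} => φL (X (p.1, (p.2 : Fin (m + 1)))))))) (∑ k' ∈ Finset.univ.erase k₀,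
            φL (X (i, (k' : Fin (m + 1)))) *
              (β k' - φL (C (NesterenkoK.xbar 𝔭 k')) * (φL (C (NesterenkoK.xbar 𝔭 j)))⁻¹ * β j)) := by
          refine Finset.sum_induction _ (fun y => IsAlgebraic (Algebra.adjoin K (((Set.range (fun k : Fin (m + 1) => φL (C (NesterenkoK.xbar 𝔭 k)))) ∪ (Set.range β)) ∪ (Set.range (fun p : Fin (r' + 1) × {k : Fin (m + 1) // k ≠ j ∧ k ≠ (k₀ : Fin (m + 1))} => φL (X (p.1, (p.2 : Fin (m + 1)))))))) y) (fun a b ha hb => ha.add hb)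
            isAlgebraic_zero ?_
          intro k' hk'
          have hne : (k' : Fin (m + 1)) ≠ (k₀ : Fin (m + 1)) := fun e =>
            Finset.ne_of_mem_erase hk' (Subtype.ext e)
          exact (hmemT _ (Or.inr ⟨(i, ⟨k', k'.2, hne⟩), rfl⟩)).mul (hγT k')
        have heq : φL (X (i, (k₀ : Fin (m + 1)))) =
            -(∑ k' ∈ Finset.univ.erase k₀, φL (X (i, (k' : Fin (m + 1)))) *
              (β k' - φL (C (NesterenkoK.xbar 𝔭 k')) * (φL (C (NesterenkoK.xbar 𝔭 j)))⁻¹ * β j)) *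
            (β k₀ - φL (C (NesterenkoK.xbar 𝔭 k₀)) * (φL (C (NesterenkoK.xbar 𝔭 j)))⁻¹ * β j)⁻¹ := by
          rw [eq_mul_inv_iff_mul_eq₀ hk₀]
          exact eq_neg_of_add_eq_zero_left hrel
        rw [heq]
        exact hrest.neg.mul (hγT k₀).inv
      · exact hmemT _ (Or.inr ⟨(i, ⟨k, k.2, hkk⟩), rfl⟩)
  -- (B2) UPPER BOUND
  have hSU' : #(Set.range (fun p : Fin (r' + 1) × {k : Fin (m + 1) // k ≠ j ∧ k ≠ (k₀ : Fin (m + 1))} => φL (X (p.1, (p.2 : Fin (m + 1)))))) ≤ (((r' + 1) * (m - 1) : ℕ) : Cardinal) := by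
    have h2 := Cardinal.mk_range_le_lift
      (f := fun p : Fin (r' + 1) × {k : Fin (m + 1) // k ≠ j ∧ k ≠ (k₀ : Fin (m + 1))} =>
        φL (X (p.1, (p.2 : Fin (m + 1)))))
    rw [Cardinal.mk_fintype (Fin (r' + 1) × {k : Fin (m + 1) // k ≠ j ∧ k ≠ (k₀ : Fin (m + 1))}),
      Cardinal.lift_natCast, Fintype.card_prod, Fintype.card_fin, Nesterenko.card_subtype_ne_ne k₀.2] at h2
    exact Cardinal.lift_le.1 (h2.trans_eq (Cardinal.lift_natCast _).symm)
  have hξtr : Algebra.trdeg K (Algebra.adjoin K (Set.range (fun k : Fin (m + 1) => φL (C (NesterenkoK.xbar 𝔭 k))))) = ((r' + 1 : ℕ) : Cardinal) := by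
    have hψ : Function.Injective (φL.comp (IsScalarTower.toAlgHom K (FractionRing (MvPolynomial (Fin (m + 1)) K ⧸ 𝔭)) (MvPolynomial (Fin (r' + 1) × Fin (m + 1)) (FractionRing (MvPolynomial (Fin (m + 1)) K ⧸ 𝔭))))) :=
      hφ.comp (C_injective _ _)
    have himage := Literature.RingTheory.NoetherNormalization.lift_trdeg_adjoin_image_eq
      (φL.comp (IsScalarTower.toAlgHom K (FractionRing (MvPolynomial (Fin (m + 1)) K ⧸ 𝔭)) (MvPolynomial (Fin (r' + 1) × Fin (m + 1)) (FractionRing (MvPolynomial (Fin (m + 1)) K ⧸ 𝔭))))) hψ (Set.range (NesterenkoK.xbar 𝔭))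
    rw [Cardinal.lift_id, Cardinal.lift_id, ← Set.range_comp,
      NesterenkoK.trdeg_adjoin_range_xbar, NesterenkoK.trdeg_quotient_eq_of_ringKrullDim_eq hdim]
      at himage
    exact himage
  have hβtr : Algebra.trdeg K (Algebra.adjoin K (Set.range β)) ≤ (r' : Cardinal) := by
    -- `K[β] ≅ K[x̲]/Q` with `𝔭' < Q`
    have hrange : Algebra.adjoin K (Set.range β) = (aeval β : MvPolynomial (Fin (m + 1)) K →ₐ[K] Ω).range :=
      Algebra.adjoin_range_eq_range_aeval K β
    have hle : 𝔭' ≤ RingHom.ker (aeval β : MvPolynomial (Fin (m + 1)) K →ₐ[K] Ω) := fun P hP => by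
      rw [RingHom.mem_ker]
      exact hβI P hP
    have hX1 : (X k₁ - 1 : MvPolynomial (Fin (m + 1)) K) ∈ RingHom.ker (aeval β : MvPolynomial (Fin (m + 1)) K →ₐ[K] Ω) := by
      rw [RingHom.mem_ker, map_sub, aeval_X, hβk₁, map_one, sub_self]
    have hne : 𝔭' ≠ RingHom.ker (aeval β : MvPolynomial (Fin (m + 1)) K →ₐ[K] Ω) := fun e =>
      NesterenkoK.X_sub_one_notMem hhom' h𝔭'.ne_top k₁ (e ▸ hX1)
    haveI : (RingHom.ker (aeval β : MvPolynomial (Fin (m + 1)) K →ₐ[K] Ω)).IsPrime := RingHom.ker_isPrime _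
    -- in the domain `K[x̲]/𝔭'`
    haveI : (Ideal.map (Ideal.Quotient.mk 𝔭') (RingHom.ker (aeval β : MvPolynomial (Fin (m + 1)) K →ₐ[K] Ω))).IsPrime :=
      Ideal.map_isPrime_of_surjective Ideal.Quotient.mk_surjective (by rwa [Ideal.mk_ker])
    have hne' : Ideal.map (Ideal.Quotient.mk 𝔭') (RingHom.ker (aeval β : MvPolynomial (Fin (m + 1)) K →ₐ[K] Ω)) ≠ ⊥ := by
      intro hbot
      rw [Ideal.map_eq_bot_iff_le_ker, Ideal.mk_ker] at hbot
      exact hne (le_antisymm hle hbot)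
    have hstep := Literature.RingTheory.KrullDimension.ringKrullDim_quotient_add_one_le hne'
    rw [hdim', ringKrullDim_eq_of_ringEquiv (DoubleQuot.quotQuotEquivQuotOfLE hle),
      ringKrullDim_eq_of_ringEquiv (Ideal.quotientKerEquivRange (aeval β : MvPolynomial (Fin (m + 1)) K →ₐ[K] Ω)).toRingEquiv]
      at hstep
    -- the range is an affine domain
    haveI : Algebra.FiniteType K (aeval β : MvPolynomial (Fin (m + 1)) K →ₐ[K] Ω).range :=
      Algebra.FiniteType.of_surjective (aeval β : MvPolynomial (Fin (m + 1)) K →ₐ[K] Ω).rangeRestrict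
        (AlgHom.rangeRestrict_surjective _)
    rw [Literature.RingTheory.KrullDimension.ringKrullDim_eq_trdeg K
      (aeval β : MvPolynomial (Fin (m + 1)) K →ₐ[K] Ω).range] at hstep
    have hnat : Cardinal.toNat (Algebra.trdeg K (aeval β : MvPolynomial (Fin (m + 1)) K →ₐ[K] Ω).range) + 1 ≤ r' + 1 := by
      exact_mod_cast hstep
    rw [hrange, Literature.RingTheory.KrullDimension.trdeg_eq_toNat K (aeval β : MvPolynomial (Fin (m + 1)) K →ₐ[K] Ω).range]
    exact_mod_cast (by omega : Cardinal.toNat (Algebra.trdeg K (aeval β : MvPolynomial (Fin (m + 1)) K →ₐ[K] Ω).range) ≤ r')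
  have hupper : Algebra.trdeg K (Algebra.adjoin K (((Set.range (fun k : Fin (m + 1) => φL (C (NesterenkoK.xbar 𝔭 k)))) ∪ (Set.range β)) ∪ (Set.range (fun p : Fin (r' + 1) × {k : Fin (m + 1) // k ≠ j} => φL (X (p.1, (p.2 : Fin (m + 1)))))))) ≤
      (((r' + 1) + r' + (r' + 1) * (m - 1) : ℕ) : Cardinal) := by
    have s1 : Algebra.trdeg K (Algebra.adjoin K (((Set.range (fun k : Fin (m + 1) => φL (C (NesterenkoK.xbar 𝔭 k)))) ∪ (Set.range β)) ∪ (Set.range (fun p : Fin (r' + 1) × {k : Fin (m + 1) // k ≠ j} => φL (X (p.1, (p.2 : Fin (m + 1)))))))) ≤ Algebra.trdeg K (Algebra.adjoin K (((Set.range (fun k : Fin (m + 1) => φL (C (NesterenkoK.xbar 𝔭 k)))) ∪ (Set.range β)) ∪ (Set.range (fun p : Fin (r' + 1) × {k : Fin (m + 1) // k ≠ j ∧ k ≠ (k₀ : Fin (m + 1))} => φL (X (p.1, (p.2 : Fin (m + 1)))))))) :=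
      Literature.RingTheory.NoetherNormalization.trdeg_adjoin_le_trdeg_adjoin_of_forall_isAlgebraic halgU
    have s2 : Algebra.trdeg K (Algebra.adjoin K (((Set.range (fun k : Fin (m + 1) => φL (C (NesterenkoK.xbar 𝔭 k)))) ∪ (Set.range β)) ∪ (Set.range (fun p : Fin (r' + 1) × {k : Fin (m + 1) // k ≠ j ∧ k ≠ (k₀ : Fin (m + 1))} => φL (X (p.1, (p.2 : Fin (m + 1)))))))) ≤ Algebra.trdeg K (Algebra.adjoin K ((Set.range (fun k : Fin (m + 1) => φL (C (NesterenkoK.xbar 𝔭 k)))) ∪ (Set.range β))) + #(Set.range (fun p : Fin (r' + 1) × {k : Fin (m + 1) // k ≠ j ∧ k ≠ (k₀ : Fin (m + 1))} => φL (X (p.1, (p.2 : Fin (m + 1)))))) :=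
      Literature.RingTheory.NoetherNormalization.trdeg_adjoin_union_le _ _
    have s3 : Algebra.trdeg K (Algebra.adjoin K ((Set.range (fun k : Fin (m + 1) => φL (C (NesterenkoK.xbar 𝔭 k)))) ∪ (Set.range β))) ≤
        Algebra.trdeg K (Algebra.adjoin K (Set.range (fun k : Fin (m + 1) => φL (C (NesterenkoK.xbar 𝔭 k))))) + Algebra.trdeg K (Algebra.adjoin K (Set.range β)) :=
      Literature.RingTheory.NoetherNormalization.trdeg_adjoin_union_le_add _ _
    calc _ ≤ _ := s1
      _ ≤ _ := s2
      _ ≤ (Algebra.trdeg K (Algebra.adjoin K (Set.range (fun k : Fin (m + 1) => φL (C (NesterenkoK.xbar 𝔭 k))))) + Algebra.trdeg K (Algebra.adjoin K (Set.range β))) + #(Set.range (fun p : Fin (r' + 1) × {k : Fin (m + 1) // k ≠ j ∧ k ≠ (k₀ : Fin (m + 1))} => φL (X (p.1, (p.2 : Fin (m + 1)))))) :=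
          add_le_add s3 le_rfl
      _ ≤ (((r' + 1 : ℕ) : Cardinal) + (r' : Cardinal)) + (((r' + 1) * (m - 1) : ℕ) : Cardinal) :=
          add_le_add (add_le_add hξtr.le hβtr) hSU'
      _ = (((r' + 1) + r' + (r' + 1) * (m - 1) : ℕ) : Cardinal) := by push_cast; ring
  -- (B3) LOWER BOUND: `u_{ik}` (`k ≠ j`) and a transcendence basis of `K[x̄]` are independent
  obtain ⟨e₀, he₀⟩ := Literature.RingTheory.NoetherNormalization.exists_algEquiv_adjoin_preimage
    (K := K) (Algebra.adjoin K (Set.range (NesterenkoK.xbar 𝔭)) : Subalgebra K (FractionRing (MvPolynomial (Fin (m + 1)) K ⧸ 𝔭)))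
    (t := Set.range (NesterenkoK.xbar 𝔭)) (fun x hx => Algebra.subset_adjoin hx)
  haveI : Algebra.IsAlgebraic (Algebra.adjoin K
      (((↑) : Algebra.adjoin K (Set.range (NesterenkoK.xbar 𝔭)) → (FractionRing (MvPolynomial (Fin (m + 1)) K ⧸ 𝔭))) ⁻¹' Set.range (NesterenkoK.xbar 𝔭)))
      (Algebra.adjoin K (Set.range (NesterenkoK.xbar 𝔭))) := by
    refine ⟨fun a => ?_⟩
    have ha : IsAlgebraic (Algebra.adjoin K (Set.range (NesterenkoK.xbar 𝔭))) (a : (FractionRing (MvPolynomial (Fin (m + 1)) K ⧸ 𝔭))) :=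
      isAlgebraic_algebraMap a
    refine ha.of_ringHom_of_comp_eq (f := (e₀ : _ →+* Algebra.adjoin K (Set.range (NesterenkoK.xbar 𝔭))))
      (g := ((Algebra.adjoin K (Set.range (NesterenkoK.xbar 𝔭))).val : _ →+* (FractionRing (MvPolynomial (Fin (m + 1)) K ⧸ 𝔭))))
      e₀.surjective Subtype.val_injective ?_
    ext x
    simp only [RingHom.coe_comp, Function.comp_apply]
    exact he₀ x
  obtain ⟨B, hBt, hB⟩ := exists_isTranscendenceBasis_subset (R := K)
    (A := Algebra.adjoin K (Set.range (NesterenkoK.xbar 𝔭)))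
    (((↑) : Algebra.adjoin K (Set.range (NesterenkoK.xbar 𝔭)) → (FractionRing (MvPolynomial (Fin (m + 1)) K ⧸ 𝔭))) ⁻¹' Set.range (NesterenkoK.xbar 𝔭))
  have hcardB : #B = ((r' + 1 : ℕ) : Cardinal) := by
    rw [hB.cardinalMk_eq_trdeg, NesterenkoK.trdeg_adjoin_range_xbar,
      NesterenkoK.trdeg_quotient_eq_of_ringKrullDim_eq hdim]
  have hxind : AlgebraicIndependent K
      (fun b : B => ((b : Algebra.adjoin K (Set.range (NesterenkoK.xbar 𝔭))) : (FractionRing (MvPolynomial (Fin (m + 1)) K ⧸ 𝔭)))) :=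
    hB.1.map' (f := (Algebra.adjoin K (Set.range (NesterenkoK.xbar 𝔭))).val)
      (fun u v huv => Subtype.ext huv)
  have hemb : Function.Injective (fun p : Fin (r' + 1) × {k : Fin (m + 1) // k ≠ j} =>
      (p.1, (p.2 : Fin (m + 1)))) := by
    rintro ⟨a, k⟩ ⟨a', k'⟩ e
    simp only [Prod.mk.injEq] at e
    rw [e.1, Subtype.ext e.2]
  have huind : AlgebraicIndependent (FractionRing (MvPolynomial (Fin (m + 1)) K ⧸ 𝔭)) (fun p : Fin (r' + 1) × {k : Fin (m + 1) // k ≠ j} =>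
      φL (X (p.1, (p.2 : Fin (m + 1))))) :=
    ((MvPolynomial.algebraicIndependent_X (Fin (r' + 1) × Fin (m + 1)) (FractionRing (MvPolynomial (Fin (m + 1)) K ⧸ 𝔭))).comp _ hemb).map'
      (f := φT) hφT
  have hind := hxind.sumElim_comp huind
  have hmemN : ∀ v, Sum.elim (fun p : Fin (r' + 1) × {k : Fin (m + 1) // k ≠ j} =>
      φL (X (p.1, (p.2 : Fin (m + 1)))))
      (algebraMap (FractionRing (MvPolynomial (Fin (m + 1)) K ⧸ 𝔭)) Ω ∘ fun b : B =>
        ((b : Algebra.adjoin K (Set.range (NesterenkoK.xbar 𝔭))) : (FractionRing (MvPolynomial (Fin (m + 1)) K ⧸ 𝔭)))) v ∈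
      Algebra.adjoin K (((Set.range (fun k : Fin (m + 1) => φL (C (NesterenkoK.xbar 𝔭 k)))) ∪ (Set.range β)) ∪ (Set.range (fun p : Fin (r' + 1) × {k : Fin (m + 1) // k ≠ j} => φL (X (p.1, (p.2 : Fin (m + 1))))))) := by
    rintro (p | b)
    · exact Algebra.subset_adjoin (Or.inr ⟨p, rfl⟩)
    · simp only [Sum.elim_inr, Function.comp_apply]
      obtain ⟨k, hk⟩ := hBt b.2
      rw [← hφC, ← hk]
      exact Algebra.subset_adjoin (Or.inl (Or.inl ⟨k, rfl⟩))
  have hind' := AlgebraicIndependent.of_comp (Algebra.adjoin K (((Set.range (fun k : Fin (m + 1) => φL (C (NesterenkoK.xbar 𝔭 k)))) ∪ (Set.range β)) ∪ (Set.range (fun p : Fin (r' + 1) × {k : Fin (m + 1) // k ≠ j} => φL (X (p.1, (p.2 : Fin (m + 1)))))))).val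
    (x := fun v => (⟨_, hmemN v⟩ : Algebra.adjoin K (((Set.range (fun k : Fin (m + 1) => φL (C (NesterenkoK.xbar 𝔭 k)))) ∪ (Set.range β)) ∪ (Set.range (fun p : Fin (r' + 1) × {k : Fin (m + 1) // k ≠ j} => φL (X (p.1, (p.2 : Fin (m + 1))))))))) hind
  have hlower := hind'.cardinalMk_le_trdeg
  rw [Cardinal.mk_sum, Cardinal.mk_fintype (Fin (r' + 1) × {k : Fin (m + 1) // k ≠ j}),
    Fintype.card_prod, Fintype.card_fin, hcardB, Cardinal.lift_natCast, Cardinal.lift_natCast]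
    at hlower
  have hcardι : Fintype.card {k : Fin (m + 1) // k ≠ j} = m := by simp
  rw [hcardι] at hlower
  -- (B4) contradiction
  have key := hlower.trans hupper
  have key' : (r' + 1) * m + (r' + 1) ≤ (r' + 1) + r' + (r' + 1) * (m - 1) := by exact_mod_cast key
  obtain ⟨m', rfl⟩ := Nat.exists_eq_add_of_le hm
  rw [Nat.add_sub_cancel_left] at key'
  nlinarith [key']

set_option synthInstance.maxHeartbeats 400000 in
set_option maxHeartbeats 1600000 in
/-- **The Chow form determines the prime** (one inclusion): for homogeneous primes `𝔭, 𝔭'` of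
`K[x₀, …, x_m]` (in fact only `𝔭'` needs to be homogeneous) with
`dim K[x̲]/𝔭 = dim K[x̲]/𝔭' = r ≥ 1` and `𝔭̄(r) = 𝔭̄'(r)`, one has `𝔭' ⊆ 𝔭`. The generic `r`-tuple of hyperplanes through the generic point `ξ` of `V(𝔭)`
annihilates `𝔭̄(r) = 𝔭̄'(r)`, so (Hauptsatz, `exists_mem_elimIdeal_aeval_ne_zero_of_isAlgClosed`)
meets `V(𝔭')` in a point `β`; by `false_of_off_generic_point`, `β = ξ` projectively, whence the
forms of `𝔭'` vanish at `ξ`, i.e. lie in `𝔭` (Hodge–Pedoe II, Ch. X §7: "no two distinct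
varieties can have the same Cayley form"). [cite: NesterenkoPhilippon2001, Ch. 3 Prop. 4.4 (p. 38)] -/
theorem le_of_elimIdeal_eq {r : ℕ} (𝔭 𝔭' : Ideal (MvPolynomial (Fin (m + 1)) K)) [h𝔭 : 𝔭.IsPrime] [h𝔭' : 𝔭'.IsPrime]
    (hr : 1 ≤ r) (hdim : ringKrullDim (MvPolynomial (Fin (m + 1)) K ⧸ 𝔭) = r)
    (hhom' : letI := MvPolynomial.gradedAlgebra (σ := Fin (m + 1)) (R := K)
      𝔭'.IsHomogeneous (homogeneousSubmodule (Fin (m + 1)) K))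
    (hdim' : ringKrullDim (MvPolynomial (Fin (m + 1)) K ⧸ 𝔭') = r)
    (h : NesterenkoK.elimIdeal 𝔭 r = NesterenkoK.elimIdeal 𝔭' r) : 𝔭' ≤ 𝔭 := by
  classical
  obtain ⟨r', rfl⟩ : ∃ r', r = r' + 1 := ⟨r - 1, by omega⟩
  have hdim0 : ringKrullDim (MvPolynomial (Fin (m + 1)) K ⧸ 𝔭) ≠ 0 := by
    rw [hdim]; exact_mod_cast Nat.succ_ne_zero r'
  obtain ⟨j, hj⟩ := Literature.RingTheory.MvPolynomial.exists_X_notMem_of_ringKrullDim_ne_zero hdim0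
  -- the injective `K`-algebra map `φ : L[U] → Ω`, `Ω` an algebraic closure of `Frac(L[U])`
  set φ : (MvPolynomial (Fin (r' + 1) × Fin (m + 1)) (FractionRing (MvPolynomial (Fin (m + 1)) K ⧸ 𝔭))) →ₐ[K] (AlgebraicClosure (FractionRing (MvPolynomial (Fin (r' + 1) × Fin (m + 1)) (FractionRing (MvPolynomial (Fin (m + 1)) K ⧸ 𝔭))))) := IsScalarTower.toAlgHom K (MvPolynomial (Fin (r' + 1) × Fin (m + 1)) (FractionRing (MvPolynomial (Fin (m + 1)) K ⧸ 𝔭))) (AlgebraicClosure (FractionRing (MvPolynomial (Fin (r' + 1) × Fin (m + 1)) (FractionRing (MvPolynomial (Fin (m + 1)) K ⧸ 𝔭))))) with hφdef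
  have hφ : Function.Injective φ := by
    change Function.Injective (algebraMap (MvPolynomial (Fin (r' + 1) × Fin (m + 1)) (FractionRing (MvPolynomial (Fin (m + 1)) K ⧸ 𝔭))) (AlgebraicClosure (FractionRing (MvPolynomial (Fin (r' + 1) × Fin (m + 1)) (FractionRing (MvPolynomial (Fin (m + 1)) K ⧸ 𝔭))))))
    rw [IsScalarTower.algebraMap_eq (MvPolynomial (Fin (r' + 1) × Fin (m + 1)) (FractionRing (MvPolynomial (Fin (m + 1)) K ⧸ 𝔭))) (FractionRing (MvPolynomial (Fin (r' + 1) × Fin (m + 1)) (FractionRing (MvPolynomial (Fin (m + 1)) K ⧸ 𝔭)))) (AlgebraicClosure (FractionRing (MvPolynomial (Fin (r' + 1) × Fin (m + 1)) (FractionRing (MvPolynomial (Fin (m + 1)) K ⧸ 𝔭)))))]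
    exact (algebraMap (FractionRing (MvPolynomial (Fin (r' + 1) × Fin (m + 1)) (FractionRing (MvPolynomial (Fin (m + 1)) K ⧸ 𝔭)))) (AlgebraicClosure (FractionRing (MvPolynomial (Fin (r' + 1) × Fin (m + 1)) (FractionRing (MvPolynomial (Fin (m + 1)) K ⧸ 𝔭)))))).injective.comp (IsFractionRing.injective (MvPolynomial (Fin (r' + 1) × Fin (m + 1)) (FractionRing (MvPolynomial (Fin (m + 1)) K ⧸ 𝔭))) _)
  have hx : φ (C (NesterenkoK.xbar 𝔭 j)) ≠ 0 := by
    intro h0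
    exact NesterenkoK.xbar_ne_zero 𝔭 hj (C_injective _ _ (hφ (by rw [h0, C_0, map_zero])))
  -- (1) the generic hyperplanes through `ξ` annihilate `𝔭̄'(r) = 𝔭̄(r)`
  have h1 : ∀ G ∈ NesterenkoK.elimIdeal 𝔭' (r' + 1),
      aeval (fun p : Fin (r' + 1) × Fin (m + 1) =>
        φ (NesterenkoK.pivotMap 𝔭 (r' + 1) j (X (Sum.inl p)))) G = 0 := by
    intro G hG
    rw [← h] at hG
    exact (NesterenkoK.aeval_pivot_eq_zero_iff 𝔭 hj φ hφ G).2 hG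
  -- (2) the Hauptsatz: they have a common zero `β₀` on `V(𝔭')`
  have h2 : ∃ β : Fin (m + 1) → (AlgebraicClosure (FractionRing (MvPolynomial (Fin (r' + 1) × Fin (m + 1)) (FractionRing (MvPolynomial (Fin (m + 1)) K ⧸ 𝔭))))), β ≠ 0 ∧ (∀ P ∈ 𝔭', aeval β P = 0) ∧
      ∀ i : Fin (r' + 1), ∑ k, φ (NesterenkoK.pivotMap 𝔭 (r' + 1) j (X (Sum.inl (i, k)))) * β k = 0 := by
    by_contra hne
    push Not at hne
    obtain ⟨G, hG, hGu⟩ := NesterenkoK.exists_mem_elimIdeal_aeval_ne_zero hhom'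
      (fun p : Fin (r' + 1) × Fin (m + 1) => φ (NesterenkoK.pivotMap 𝔭 (r' + 1) j (X (Sum.inl p))))
      (fun β hβ0 hβI => hne β hβ0 hβI)
    exact hGu (h1 G hG)
  obtain ⟨β₀, hβ₀, hβ₀I, hβ₀L⟩ := h2
  -- normalise: `β k₁ = 1`
  obtain ⟨k₁, hk₁⟩ := Function.ne_iff.1 hβ₀
  set β : Fin (m + 1) → (AlgebraicClosure (FractionRing (MvPolynomial (Fin (r' + 1) × Fin (m + 1)) (FractionRing (MvPolynomial (Fin (m + 1)) K ⧸ 𝔭))))) := (β₀ k₁)⁻¹ • β₀ with hβdef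
  have hβk₁ : β k₁ = 1 := by
    simp only [hβdef, Pi.smul_apply, smul_eq_mul]
    exact inv_mul_cancel₀ hk₁
  have hβI : ∀ P ∈ 𝔭', aeval β P = 0 := NesterenkoK.aeval_smul_eq_zero_of_forall hhom' hβ₀I _
  have hβL : ∀ i : Fin (r' + 1),
      ∑ k, φ (NesterenkoK.pivotMap 𝔭 (r' + 1) j (X (Sum.inl (i, k)))) * β k = 0 := by
    intro i
    have hi := hβ₀L i
    have e : ∑ k, φ (NesterenkoK.pivotMap 𝔭 (r' + 1) j (X (Sum.inl (i, k)))) * β k =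
        (β₀ k₁)⁻¹ * ∑ k, φ (NesterenkoK.pivotMap 𝔭 (r' + 1) j (X (Sum.inl (i, k)))) * β₀ k := by
      rw [Finset.mul_sum]
      refine Finset.sum_congr rfl fun k _ => ?_
      simp only [hβdef, Pi.smul_apply, smul_eq_mul]
      ring
    rw [e, hi, mul_zero]
  -- (3) the linear conditions in terms of `γ_k = β_k − ξ_k ξ_j⁻¹ β_j`
  have hγ : ∀ i : Fin (r' + 1), ∑ k : {k : Fin (m + 1) // k ≠ j},
      φ (X (i, (k : Fin (m + 1)))) *
        (β k - φ (C (NesterenkoK.xbar 𝔭 k)) * (φ (C (NesterenkoK.xbar 𝔭 j)))⁻¹ * β j) = 0 := by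
    intro i
    rw [← NesterenkoK.sum_pivot_mul_eq 𝔭 hj φ hφ β i]
    exact hβL i
  by_cases hγ0 : ∀ k : {k : Fin (m + 1) // k ≠ j},
      β k - φ (C (NesterenkoK.xbar 𝔭 k)) * (φ (C (NesterenkoK.xbar 𝔭 j)))⁻¹ * β j = 0
  · -- `β = c ξ`, so the forms of `𝔭'` vanish at `ξ`
    have hβj : β j ≠ 0 := by
      intro h0
      have hk : β k₁ = 0 := by
        by_cases hkj : k₁ = j
        · rw [hkj]; exact h0
        · have := hγ0 ⟨k₁, hkj⟩
          simp only [h0, mul_zero, sub_zero] at this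
          exact this
      rw [hβk₁] at hk
      exact one_ne_zero hk
    have hc : β j * (φ (C (NesterenkoK.xbar 𝔭 j)))⁻¹ ≠ 0 := mul_ne_zero hβj (inv_ne_zero hx)
    have hβc : β = (β j * (φ (C (NesterenkoK.xbar 𝔭 j)))⁻¹) • fun k => φ (C (NesterenkoK.xbar 𝔭 k)) := by
      funext k
      simp only [Pi.smul_apply, smul_eq_mul]
      by_cases hkj : k = j
      · rw [hkj, mul_assoc, inv_mul_cancel₀ hx, mul_one]
      · have := hγ0 ⟨k, hkj⟩
        simp only at this
        linear_combination this
    refine NesterenkoK.le_of_forall_isHomogeneous_mem hhom' fun n P hP hPn => ?_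
    have h0 : aeval β P = 0 := hβI P hP
    rw [hβc, NesterenkoK.aeval_smul_of_isHomogeneous hPn] at h0
    have h0' := (mul_eq_zero.1 h0).resolve_left (pow_ne_zero _ hc)
    exact (NesterenkoK.aeval_xbar_eq_zero_iff 𝔭 φ hφ P).1 h0'
  · -- impossible, by the transcendence-degree count
    exfalso
    push Not at hγ0
    obtain ⟨k₀, hk₀⟩ := hγ0
    exact false_of_off_generic_point 𝔭 hdim hj 𝔭' hhom' hdim' φ hφ β hβk₁ hβI hγ hk₀

/-- **Distinct homogeneous primes of the same dimension have distinct elimination ideals**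
(`K` any field): the generic-field form of hypothesis (4) of `NesterenkoPhilippon2001_ch3_prop_4_4_of`
(`NesterenkoEliminationProofs.lean`; `Nesterenko.eq_of_elimIdeal_eq` is the case `K = ℚ`) (Hodge–Pedoe II, Ch. X §7).
[cite: NesterenkoPhilippon2001, Ch. 3 Prop. 4.4 (p. 38)] -/
theorem eq_of_elimIdeal_eq (m r : ℕ) (𝔭 𝔭' : Ideal (MvPolynomial (Fin (m + 1)) K)) (hr : 1 ≤ r) (_hrm : r ≤ m)
    (hhom : letI := MvPolynomial.gradedAlgebra (σ := Fin (m + 1)) (R := K)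
      𝔭.IsHomogeneous (homogeneousSubmodule (Fin (m + 1)) K)) (h𝔭 : 𝔭.IsPrime)
    (hdim : ringKrullDim (MvPolynomial (Fin (m + 1)) K ⧸ 𝔭) = r)
    (hhom' : letI := MvPolynomial.gradedAlgebra (σ := Fin (m + 1)) (R := K)
      𝔭'.IsHomogeneous (homogeneousSubmodule (Fin (m + 1)) K)) (h𝔭' : 𝔭'.IsPrime)
    (hdim' : ringKrullDim (MvPolynomial (Fin (m + 1)) K ⧸ 𝔭') = r)
    (h : NesterenkoK.elimIdeal 𝔭 r = NesterenkoK.elimIdeal 𝔭' r) : 𝔭 = 𝔭' :=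
  le_antisymm (le_of_elimIdeal_eq 𝔭' 𝔭 hr hdim' hhom hdim h.symm)
    (le_of_elimIdeal_eq 𝔭 𝔭' hr hdim hhom' hdim' h)

end NesterenkoK

end Literature.NumberTheory.Transcendental
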